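import Summits.HodgeConjecture.HodgeConjecture.Theorems.R90S9DefiniteAeRigidityCutGeneric   -- (this seat, RULING S9-R-TG-2): the ENGINE `definiteAeRigidityAt_of_parts'` generic in the `G′`-test type
import Summits.HodgeConjecture.HodgeConjecture.Theorems.R90S9SignedReadBackOfRecordSCD      -- ★ p862424 (this seat, α1): `sgTail_of_ae_of_recordSCD` — the `hback` pin at the A-packet family of record
import Summits.HodgeConjecture.HodgeConjecture.Theorems.R90S9EvpRepOfAeAtRecordSCD          -- ★ p862452 (this seat, α2): `evpRep_of_ae_of_evp_piXiPrime` — the `hevp` pin from (AE) + «t(Π′(ξ)) = t(Π(ξ))»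
import Summits.HodgeConjecture.HodgeConjecture.Theorems.R90S9AeStringOfAe                  -- ★ p862011 (this seat): `aeString_of_ae` — the `hstring` pin
import Summits.HodgeConjecture.HodgeConjecture.Theorems.R90S9InnerFormSec146Datum          -- ★ p862404 (R90-IF-p01): the TERM `gammaSph … X : Ch14Sec6.GlobalData` (`DatumInputs`) + `rfl` read-backs + pins `gammaSph_m'_ne_zero` ∕ `_dSplit` ∕ `_mem'_piXi'_classOfSph`
import HarnessLib

/-!
# R90-TF · S9 «InnerForm-13.3.6 (c)» — (α) `definiteAeRigidity_ofDatum`: THE (AE-ⅱ) ENGINE AT THE DATUM `Γ₀^{sph} = gammaSph … X`, DATUM PINS DISCHARGED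
# (Rogawski 1990 §14.5 Thm. 14.5.1 (b) p. 238; §14.6 Thm. 14.6.1 p. 241, p. 242, Thm. 14.6.4 p. 244; §13.3 Thm. 13.3.5 p. 202)

Cell `hodgecm-mathlib`, crux H413 (`stmt-HodgeConjecture-24833`, lane `--supports … --as helper`), route of record `HCCMUnconditional` (no route verbs; count-neutral).
Programme R90-TF (brief `director/R90-BRIEF.v2.md` 1f40d54518340a35), section S9 = InnerForm-13.3.6 (c) (base `R90-IF`); seat R90-IF-p06 (g0).  DEALT BY NAME: R90-IF-plan
(g0) DEAL MAP 2026-09-04T16:51:37Z (4) «p06 = (α) `Theorems/R90S9DefiniteAeRigidityOfDatum.lean` (instantiate ★ p862161 at Γ₀; discharge hm∕hread∕hevp∕hD; leaves EXACTLY the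
law binders)», S9-R-CMP v2 22:00:32Z (e), «=» 22:11:11Z with amendments (m1)–(m4), S9-R-TG-2 22:17:42Z «(α) over the PRIMED head at `gammaSph … X` with `TG′` free».
THEOREMS ONLY (no `def`, no instance, no notation, no named-fact hypothesis, no `sorry`); imports ★ `Theorems` only (FILE B ED. 4 may import THIS file).
HONEST LABEL: HC_CM is proved only modulo the 7 printed citations (2 remaining named inputs: hLiu418 = stmt-HodgeConjecture-24832, h413 = stmt-HodgeConjecture-24833) — until
rung 0 closes.  This file proves NOTHING printed about the §14.6 comparison: it is the PAY-LINE SHAPE of FILE B ED. 4's on-path socket `SocketDefiniteAeRigidityFramedKit`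
(S9-R-K (2)) — the (AE-ⅱ) organ «e.v.p. ⟹ Π′(ξ)-membership for the definite inner form» AT THE DATUM OF RECORD, with every DATUM-SIDE pin of the engine discharged in the
kernel and EXACTLY the law binders left, each a fixed Prop over the consumer's `X` (the junction sub-sockets of B ED. 4): (S6) `h51k` = Thm. 14.5.1 (b) in the S6-B KIT SHAPE
(J5: `sock_S9_thm1451b_cm`, payer S6-A `traceGp_eq_sjTot_pinned`; SEAM 8 currying done HERE: `Transfer₀ := fun f′ f => Smooth f′ ∧ Transfer f′ f`, (m1)); (S5∕S8) `h62 h38 hexH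
hH61 hvan hvanH` = the ★ `GlobalPacketData` discrete expansions + vanishing classes at `X.G ∕ X.tr ∕ X.trH` (J8); (S7∕S9) `h64` = §14.6 at `Γ₀^{sph}` (p07's ★ `sec146_of_parts_mem`
at the datum: `sock_S9_sec146_cm`); (S5) `Pξ, hA` = «`Π(ξ) ∈ Π_a(G)`» for the packet of record; (S5, J9) `hevpXi` = «`t(Π′(ξ)) = t(Π(ξ))`» read at the kit (`sock_S9_evpXi_cm`).
DISCHARGED HERE (no binder): `π′ := classOfSph P hsph`, `hm` (★ `gammaSph_m'_ne_zero`, anisotropic `H`), `hD` (★ `gammaSph_dSplit`), `hstring` (★ `aeString_of_ae`), `hevp`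
(★ α2 `evpRep_of_ae_of_evp_piXiPrime` + `rfl` read-back), `hback` (★ α1 `sgTail_of_ae_of_recordSCD` + ★ `gammaSph_mem'_piXi'_classOfSph`), at the A-PACKET FAMILY OF RECORD
`Ξ₀ := xiPacketFamilyOfRecordSCD … μZ keys (hSCD_of_cmCharIdentityPackageTestSigned … μZ hQS)` (★ F0P3; the record's V6 data `μZ keys` are binders — B fixes the rung-0 Borel
Haar family and Keys data, ★ `exists_isHaarMeasure_gqs_quotient_center` ∕ ★ `exists_keysData_of_keysCaseTwo`).  Scope: FRAMED `H` (`ι T hT`) and `P` `K_c`-spherical (`hsph`,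
S9-R-Kc) — the classes `Γ₀^{sph}` carries.  Conclusion = the (S-G) tail of ★ `definiteXiMembership_of_ch14`'s `hRig` for `ξ`, BYTE FOR BYTE.
Proof: ★ `definiteAeRigidityAt_of_parts'` at `Γ := gammaSph … X`, `Transfer := Transfer₀`, the five discharges above.  Axioms TRIO.

[cite: Rogawski1990, §14.5 Thm. 14.5.1 (b) p. 238; §14.6 Thm. 14.6.1 (14.6.1) p. 241, p. 242, Thm. 14.6.4 p. 244; §13.3 Thm. 13.3.5 p. 202, p. 201; §13.6 pp. 208–210; §13.1 Prop. 13.1.3 (d), Prop. 13.1.4 p. 199; §12.2 (2) p. 174; §14.2 p. 233]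
[cite: FlathCorvallis1979, Thm. 3] [cite: CartierCorvallis1979, §IV.1 Cor. 4.1]
-/

set_option autoImplicit false
-- the mandated namespace repeats `HodgeConjecture.HodgeConjecture`, as in every `Theorems/*.lean` of this sub-problem
set_option linter.dupNamespace false

noncomputable section

open NumberField IsDedekindDomain MeasureTheory
open scoped Matrix ComplexOrder

open Literature.NumberTheory Literature.NumberTheory.Automorphic Literature.NumberTheory.Automorphic.UnitaryGroup
open Literature.NumberTheory.Automorphic.IdeleClassGroup
open Literature.NumberTheory.GaloisRepresentations
open Literature.NumberTheory.Rogawski1990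

namespace Summit.HodgeConjecture.HodgeConjecture.R90.S9

open Summit.HodgeConjecture.HodgeConjecture.Cruxes.H413
open Summit.HodgeConjecture.HodgeConjecture.Cruxes.H413.F0P3GlobalPacket Summit.HodgeConjecture.HodgeConjecture.Cruxes.H413.F0P3LocalPacketKit
open Summit.HodgeConjecture.HodgeConjecture.Cruxes.H413.F0P3XiPacketFamilyOfRecordSCD (xiPacketFamilyOfRecordSCD hSCD_of_cmCharIdentityPackageTestSigned
  hSCD_of_cmCharIdentityPackageTestSigned_fst)

open scoped Classical in
set_option synthInstance.maxHeartbeats 400000 in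
set_option maxHeartbeats 8000000 in
/-- **(α) `definiteAeRigidity_ofDatum` — THE (AE-ⅱ) ENGINE AT THE DATUM OF RECORD `Γ₀^{sph} = gammaSph … X`.**  Binders: the (S-G) instance prefix of ★ `definiteXiMembership_of_ch14`'s
`hRig` (`L H hH hHd`, `hanis`, frames, `Δ mH mG νG νH`, `μω hμu hμω`, the SIGNED package `hQS`), the FRAME `(ι T hT)` and SCOPE `hsph : IsKcSpherical … P` of `Γ₀^{sph}`
(S9-R-Kc), `ξ μA P`, (AE) for `ξ` (BYTES of `hRig`'s clause), the record's V6 data `μZ keys`, the kit `𝔩` and the OWED bundle `X : DatumInputs …` of ★ `gammaSph`; then the LAW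
BINDERS ONLY: (S6) `h51k` Thm. 14.5.1 (b) in kit shape over loose `(Smooth Transfer TransferH SθG SθH)` with `X.traceL` (J5); (S5∕S8) `PSVanish PSVanishH MatchH h62 h38 hexH hH61
hvan hvanH` (the hypotheses of ★ `Ch14Bridge.thm1461_of_thm1451b_of_prop1362` at `X.G X.tr X.trH`; `hvan` over `Transfer₀ := Smooth ∧ Transfer`); (S7) `h64 : Γ₀.thm1461 Transfer₀
TransferH → Γ₀.sec146_evp ∧ Γ₀.sec146_partition ∧ Γ₀.thm1464a`; (S5) `Pξ : X.G.Packet`, `hA : X.G.IsAPacket Pξ`; (J9) `hevpXi : evp Ξ₀ 𝔩 (piXiPrime Ξ₀ ξ) (X.finOfG Pξ)`.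
Conclusion = the (S-G) tail of `hRig` BYTE FOR BYTE.  Proof: ★ `definiteAeRigidityAt_of_parts'` with `π′ := classOfSph P hsph`, `hm := gammaSph_m'_ne_zero`, `hD := gammaSph_dSplit`,
`hstring := aeString_of_ae`, `hevp := fun _ => evpRep_of_ae_of_evp_piXiPrime … hevpXi` (α2, `rfl` read-back), `hback := sgTail_of_ae_of_recordSCD …` (α1) after ★
`gammaSph_mem'_piXi'_classOfSph`, and `h51 := h51k` curried (SEAM 8).  No `sorry`; axioms `propext`, `Classical.choice`, `Quot.sound`.
[cite: Rogawski1990, §14.5 Thm. 14.5.1 (b) p. 238; §14.6 Thm. 14.6.1 p. 241, p. 242, Thm. 14.6.4 p. 244; §13.3 Thm. 13.3.5 p. 202; §13.1 Prop. 13.1.3 (d), Prop. 13.1.4 p. 199; §12.2 (2) p. 174] [cite: FlathCorvallis1979, Thm. 3] -/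
theorem definiteAeRigidity_ofDatum
    (L : Type) [Field L] [NumberField L] [IsCMField L] (H : Matrix (Fin 3) (Fin 3) L)
    (hH : (H.map (cmConjRingHom L))ᵀ = H) (hHd : IsUnit H.det)
    [∀ v : HeightOneSpectrum (𝓞 ↥(maximalRealSubfield L)), MeasurableSpace ((cmDatum L 3 H).Local v)]
    [∀ v : HeightOneSpectrum (𝓞 ↥(maximalRealSubfield L)),
      MeasurableSpace ((cmDatum L 2 (Matrix.of fun i j : Fin 2 => if i.val + j.val + 1 = 2 then (1 : L) else 0)).Local v ×
        (cmDatum L 1 (Matrix.of fun i j : Fin 1 => if i.val + j.val + 1 = 1 then (1 : L) else 0)).Local v)]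
    [∀ (v : HeightOneSpectrum (𝓞 ↥(maximalRealSubfield L)))
        (a : ((cmDatum L 2 (Matrix.of fun i j : Fin 2 => if i.val + j.val + 1 = 2 then (1 : L) else 0)).Local v ×
          (cmDatum L 1 (Matrix.of fun i j : Fin 1 => if i.val + j.val + 1 = 1 then (1 : L) else 0)).Local v)),
      MeasurableSpace (((cmDatum L 2 (Matrix.of fun i j : Fin 2 => if i.val + j.val + 1 = 2 then (1 : L) else 0)).Local v ×
          (cmDatum L 1 (Matrix.of fun i j : Fin 1 => if i.val + j.val + 1 = 1 then (1 : L) else 0)).Local v) ⧸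
        Subgroup.centralizer ({a} : Set ((cmDatum L 2 (Matrix.of fun i j : Fin 2 => if i.val + j.val + 1 = 2 then (1 : L) else 0)).Local v ×
          (cmDatum L 1 (Matrix.of fun i j : Fin 1 => if i.val + j.val + 1 = 1 then (1 : L) else 0)).Local v)))]
    [∀ (v : HeightOneSpectrum (𝓞 ↥(maximalRealSubfield L))) (γ : (cmDatum L 3 H).Local v),
      MeasurableSpace ((cmDatum L 3 H).Local v ⧸ Subgroup.centralizer ({γ} : Set ((cmDatum L 3 H).Local v)))]
    (Δ : ∀ v : HeightOneSpectrum (𝓞 ↥(maximalRealSubfield L)), LocalTransferFactor L H v)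
    (mH : ∀ v : HeightOneSpectrum (𝓞 ↥(maximalRealSubfield L)),
      OrbitalMeasureFamily ((cmDatum L 2 (Matrix.of fun i j : Fin 2 => if i.val + j.val + 1 = 2 then (1 : L) else 0)).Local v ×
        (cmDatum L 1 (Matrix.of fun i j : Fin 1 => if i.val + j.val + 1 = 1 then (1 : L) else 0)).Local v))
    (mG : ∀ v : HeightOneSpectrum (𝓞 ↥(maximalRealSubfield L)), OrbitalMeasureFamily ((cmDatum L 3 H).Local v))
    (νG : ∀ v : HeightOneSpectrum (𝓞 ↥(maximalRealSubfield L)), Measure ((cmDatum L 3 H).Local v))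
    (νH : ∀ v : HeightOneSpectrum (𝓞 ↥(maximalRealSubfield L)),
      Measure ((cmDatum L 2 (Matrix.of fun i j : Fin 2 => if i.val + j.val + 1 = 2 then (1 : L) else 0)).Local v ×
        (cmDatum L 1 (Matrix.of fun i j : Fin 1 => if i.val + j.val + 1 = 1 then (1 : L) else 0)).Local v))
    [∀ v : HeightOneSpectrum (𝓞 ↥(maximalRealSubfield L)), BorelSpace ((cmDatum L 3 H).Local v)]
    [∀ v : HeightOneSpectrum (𝓞 ↥(maximalRealSubfield L)),
      BorelSpace ((cmDatum L 2 (Matrix.of fun i j : Fin 2 => if i.val + j.val + 1 = 2 then (1 : L) else 0)).Local v ×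
        (cmDatum L 1 (Matrix.of fun i j : Fin 1 => if i.val + j.val + 1 = 1 then (1 : L) else 0)).Local v)]
    [∀ (v : HeightOneSpectrum (𝓞 ↥(maximalRealSubfield L)))
        (a : ((cmDatum L 2 (Matrix.of fun i j : Fin 2 => if i.val + j.val + 1 = 2 then (1 : L) else 0)).Local v ×
          (cmDatum L 1 (Matrix.of fun i j : Fin 1 => if i.val + j.val + 1 = 1 then (1 : L) else 0)).Local v)),
      BorelSpace (((cmDatum L 2 (Matrix.of fun i j : Fin 2 => if i.val + j.val + 1 = 2 then (1 : L) else 0)).Local v ×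
          (cmDatum L 1 (Matrix.of fun i j : Fin 1 => if i.val + j.val + 1 = 1 then (1 : L) else 0)).Local v) ⧸
        Subgroup.centralizer ({a} : Set ((cmDatum L 2 (Matrix.of fun i j : Fin 2 => if i.val + j.val + 1 = 2 then (1 : L) else 0)).Local v ×
          (cmDatum L 1 (Matrix.of fun i j : Fin 1 => if i.val + j.val + 1 = 1 then (1 : L) else 0)).Local v)))]
    [∀ (v : HeightOneSpectrum (𝓞 ↥(maximalRealSubfield L))) (γ : (cmDatum L 3 H).Local v),
      BorelSpace ((cmDatum L 3 H).Local v ⧸ Subgroup.centralizer ({γ} : Set ((cmDatum L 3 H).Local v)))]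
    [∀ v, (νG v).IsHaarMeasure] [∀ v, (νG v).IsMulRightInvariant] [∀ v, (νH v).IsHaarMeasure] [∀ v, (νH v).IsMulRightInvariant]
    (hanis : ∀ x : Fin 3 → L, Literature.AlgebraicGeometry.ShimuraVarieties.hermForm (cmConjRingHom L) H x x = 0 → x = 0)
    (μω : HeckeCharacter L) (hμu : μω.IsUnitary)
    (hμω : ∀ x : Literature.NumberTheory.GaloisRepresentations.ideleGroup ↥(maximalRealSubfield L),
      μω (AdeleRing.ideleBaseChange (↥(maximalRealSubfield L)) L x) = quadraticHeckeCharCM L x)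
    (hQS : CMCharIdentityPackageTestSigned L H hH hHd νH νG μω hμu Δ mH mG)
    -- THE FRAME of `Γ₀^{sph}` (S9-R-b′ ∕ consumer :703): `ᵗT̄ · H^ι · T = J`
    (ι : L →+* ℂ) (T : GL (Fin 3) ℂ)
    (hT : (T : Matrix (Fin 3) (Fin 3) ℂ)ᴴ * H.map ι * (T : Matrix (Fin 3) (Fin 3) ℂ) = Literature.Geometry.ComplexHyperbolic.BallModel.J)
    (ξ : OneDimAutRepH L)
    (μA : Measure (adelicGroupData (↥(maximalRealSubfield L)) L (IsCMField.complexConj L) 3 H).automorphicQuotient)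
    [(adelicGroupData (↥(maximalRealSubfield L)) L (IsCMField.complexConj L) 3 H).IsAutomorphicMeasure μA]
    (P : DiscreteAutomorphicRep (adelicGroupData (↥(maximalRealSubfield L)) L (IsCMField.complexConj L) 3 H) μA)
    -- THE SCOPE of `Γ₀^{sph}` (S9-R-Kc): `P_∞` is `K_c`-spherical
    (hsph : InnerFormSec146.IsKcSpherical L ι H T hT μA P)
    (hAE :
      (∃ S : Finset (HeightOneSpectrum (𝓞 ↥(maximalRealSubfield L))),
        (∀ v : HeightOneSpectrum (𝓞 ↥(maximalRealSubfield L)), v ∉ S →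
          ∀ (hns : ∀ w : PlacesOver L v, IsCMField.complexConj L • w.1 = w.1)
            (T : GL (Fin 3) (LocalRing L v)) (a : LocalRing L v) (ha : IsUnit a)
            (h : formCongr (conjLocal L (IsCMField.complexConj L) v) T (H.map (algebraMap L (LocalRing L v))) =
              a • (Matrix.of fun i j : Fin 3 => if i.val + j.val + 1 = 3 then (1 : L) else 0).map (algebraMap L (LocalRing L v))),
          ∀ [MeasurableSpace (Gqs L v ⧸ Subgroup.center (Gqs L v))] [BorelSpace (Gqs L v ⧸ Subgroup.center (Gqs L v))]
            (μZ : Measure (Gqs L v ⧸ Subgroup.center (Gqs L v))) [μZ.IsHaarMeasure],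
          ∀ (π2 πn : IrrClass (Gqs L v)),
            KeysCaseTwoLabels L v (μω.semilocalComponent L v) (torusLocalComponent L (IsCMField.complexConj L) v ξ.η)
              (torusLocalComponent L (IsCMField.complexConj L) v ξ.ψ) π2 πn →
            ¬ πn.IsSquareIntegrable μZ →
            ∀ c : IrrClass ((cmDatum L 3 H).Local v),
              (IrrClass.comap (localPiEquiv L (IsCMField.complexConj L) 3 H v) c).IsConstituentOf
                  (P.finRep.smoothPart.toRepresentation.comp (inclPlace (↥(maximalRealSubfield L)) L (IsCMField.complexConj L) 3 H v)) →
              c = IrrClass.comap (cmDatumLocalCongr L v T ha h).symm πn) ∧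
        (∀ v : HeightOneSpectrum (𝓞 ↥(maximalRealSubfield L)), v ∉ S →
          ∀ (hs : ∃ w : PlacesOver L v, IsCMField.complexConj L • w.1 ≠ w.1),
            ∀ c : IrrClass ((cmDatum L 3 H).Local v),
              (IrrClass.comap (localPiEquiv L (IsCMField.complexConj L) 3 H v) c).IsConstituentOf
                  (P.finRep.smoothPart.toRepresentation.comp (inclPlace (↥(maximalRealSubfield L)) L (IsCMField.complexConj L) 3 H v)) →
              c ∈ (cmSplitPacket L H hH hHd v (splitWitness v hs) (splitWitness_spec v hs) (ξ.splitν₀ μω (splitWitness v hs).1)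
                (ξ.locψ (splitWitness v hs).1) (ξ.norm_splitν₀_apply hμu (splitWitness v hs).1)
                (ξ.continuous_splitν₀ μω (splitWitness v hs).1) (ξ.norm_locψ_apply (splitWitness v hs).1)
                (ξ.continuous_locψ (splitWitness v hs).1)).members)))
    -- THE RECORD'S V6 DATA (rung-0 Borel Haar measures on the `U(Φ₃)(L⁺_v)⧸Z`, Keys' labelled pairs): fix `Ξ₀ := xiPacketFamilyOfRecordSCD … μZ keys (hSCD_…Signed … μZ hQS)`
    [∀ v : HeightOneSpectrum (𝓞 ↥(maximalRealSubfield L)), MeasurableSpace (Gqs L v ⧸ Subgroup.center (Gqs L v))]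
    [∀ v : HeightOneSpectrum (𝓞 ↥(maximalRealSubfield L)), BorelSpace (Gqs L v ⧸ Subgroup.center (Gqs L v))]
    (μZ : ∀ v : HeightOneSpectrum (𝓞 ↥(maximalRealSubfield L)), Measure (Gqs L v ⧸ Subgroup.center (Gqs L v)))
    [∀ v : HeightOneSpectrum (𝓞 ↥(maximalRealSubfield L)), (μZ v).IsHaarMeasure]
    (keys : ∀ (ξ : OneDimAutRepH L) (v : HeightOneSpectrum (𝓞 ↥(maximalRealSubfield L))),
      (∀ w : PlacesOver L v, IsCMField.complexConj L • w.1 = w.1) →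
        {p : IrrClass (Gqs L v) × IrrClass (Gqs L v) //
          KeysCaseTwoLabels L v (μω.semilocalComponent L v) (torusLocalComponent L (IsCMField.complexConj L) v ξ.η)
            (torusLocalComponent L (IsCMField.complexConj L) v ξ.ψ) p.1 p.2 ∧
          p.1.IsSquareIntegrable (μZ v) ∧ ¬ p.2.IsSquareIntegrable (μZ v)})
    -- THE KIT `𝔩` at which `G`'s packets are read, and the OWED bundle of ★ `gammaSph` (G-side `X.G := gOfRecord …`, traces, `X.traceL := ⇑𝔨.traceGp`, readers) over an arbitrary `G′`-test type
    {H' : Matrix (Fin 3) (Fin 3) L} (𝔩 : ∀ v : HeightOneSpectrum (𝓞 ↥(maximalRealSubfield L)), LocalPacketKit L H' v) {TG' : Type}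
    (X : InnerFormSec146.DatumInputs TG' (CompactlySupportedContinuousMap (cmDatum L 3 (Matrix.of fun i j : Fin 3 => if i.val + j.val + 1 = 3 then (1 : L) else 0)).Adelic ℂ)
      (CompactlySupportedContinuousMap ((cmDatum L 2 (Matrix.of fun i j : Fin 2 => if i.val + j.val + 1 = 2 then (1 : L) else 0)).Adelic × (cmDatum L 1 (Matrix.of fun i j : Fin 1 => if i.val + j.val + 1 = 1 then (1 : L) else 0)).Adelic) ℂ) L ι H T hT μA
      (xiPacketFamilyOfRecordSCD L H hH hHd μω hμu μZ keys (hSCD_of_cmCharIdentityPackageTestSigned L H hH hHd μω hμu Δ mH mG νG νH μZ hQS)) 𝔩)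
    -- (S6) Thm. 14.5.1 (b) IN THE S6-B KIT SHAPE over loose `(Smooth, Transfer, TransferH, SθG, SθH)` (B: `𝔨.Smooth`, `IsKcBiInv ∧ 𝔨.Transfer`, `𝔨.TransferH`, `𝔨.SJGtot`, `𝔨.SJHtot`; J5)
    (Smooth : TG' → Prop) (Transfer : TG' → (CompactlySupportedContinuousMap (cmDatum L 3 (Matrix.of fun i j : Fin 3 => if i.val + j.val + 1 = 3 then (1 : L) else 0)).Adelic ℂ) → Prop)
    (TransferH : TG' → (CompactlySupportedContinuousMap ((cmDatum L 2 (Matrix.of fun i j : Fin 2 => if i.val + j.val + 1 = 2 then (1 : L) else 0)).Adelic × (cmDatum L 1 (Matrix.of fun i j : Fin 1 => if i.val + j.val + 1 = 1 then (1 : L) else 0)).Adelic) ℂ) → Prop)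
    (SθG : (CompactlySupportedContinuousMap (cmDatum L 3 (Matrix.of fun i j : Fin 3 => if i.val + j.val + 1 = 3 then (1 : L) else 0)).Adelic ℂ) → ℂ)
    (SθH : (CompactlySupportedContinuousMap ((cmDatum L 2 (Matrix.of fun i j : Fin 2 => if i.val + j.val + 1 = 2 then (1 : L) else 0)).Adelic × (cmDatum L 1 (Matrix.of fun i j : Fin 1 => if i.val + j.val + 1 = 1 then (1 : L) else 0)).Adelic) ℂ) → ℂ)
    (h51k : ∀ (f' : TG') (f : (CompactlySupportedContinuousMap (cmDatum L 3 (Matrix.of fun i j : Fin 3 => if i.val + j.val + 1 = 3 then (1 : L) else 0)).Adelic ℂ))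
      (fH : (CompactlySupportedContinuousMap ((cmDatum L 2 (Matrix.of fun i j : Fin 2 => if i.val + j.val + 1 = 2 then (1 : L) else 0)).Adelic × (cmDatum L 1 (Matrix.of fun i j : Fin 1 => if i.val + j.val + 1 = 1 then (1 : L) else 0)).Adelic) ℂ)),
      Smooth f' → Transfer f' f ∧ TransferH f' fH → X.traceL f' = SθG f + (1 / 2 : ℂ) * SθH fH)
    -- (S5 ∕ S8) the ★ `GlobalPacketData` discrete expansions + vanishing classes at `X.G`, `X.tr`, `X.trH` (J8)
    (PSVanish : (CompactlySupportedContinuousMap (cmDatum L 3 (Matrix.of fun i j : Fin 3 => if i.val + j.val + 1 = 3 then (1 : L) else 0)).Adelic ℂ) → Prop)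
    (PSVanishH : (CompactlySupportedContinuousMap ((cmDatum L 2 (Matrix.of fun i j : Fin 2 => if i.val + j.val + 1 = 2 then (1 : L) else 0)).Adelic × (cmDatum L 1 (Matrix.of fun i j : Fin 1 => if i.val + j.val + 1 = 1 then (1 : L) else 0)).Adelic) ℂ) → Prop)
    (MatchH : (CompactlySupportedContinuousMap (cmDatum L 3 (Matrix.of fun i j : Fin 3 => if i.val + j.val + 1 = 3 then (1 : L) else 0)).Adelic ℂ) →
      (CompactlySupportedContinuousMap ((cmDatum L 2 (Matrix.of fun i j : Fin 2 => if i.val + j.val + 1 = 2 then (1 : L) else 0)).Adelic × (cmDatum L 1 (Matrix.of fun i j : Fin 1 => if i.val + j.val + 1 = 1 then (1 : L) else 0)).Adelic) ℂ) → Prop)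
    (h62 : X.G.DiscreteMinusEndoscopicExpansionG X.tr X.trH SθG PSVanish PSVanishH MatchH)
    (h38 : X.G.Thm1338Packetwise X.tr X.trH MatchH)
    (hexH : ∀ f, PSVanish f → ∃ fH, PSVanishH fH ∧ MatchH f fH)
    (hH61 : X.G.StableDiscreteExpansionH X.trH SθH PSVanishH)
    (hvan : ∀ (f' : TG') (f : (CompactlySupportedContinuousMap (cmDatum L 3 (Matrix.of fun i j : Fin 3 => if i.val + j.val + 1 = 3 then (1 : L) else 0)).Adelic ℂ)), Smooth f' ∧ Transfer f' f → PSVanish f)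
    (hvanH : ∀ (f' : TG') (fH : (CompactlySupportedContinuousMap ((cmDatum L 2 (Matrix.of fun i j : Fin 2 => if i.val + j.val + 1 = 2 then (1 : L) else 0)).Adelic × (cmDatum L 1 (Matrix.of fun i j : Fin 1 => if i.val + j.val + 1 = 1 then (1 : L) else 0)).Adelic) ℂ)), TransferH f' fH → PSVanishH fH)
    -- (S7 ∕ S9) §14.6 for `D = M₃(E)` AT THE DATUM: (14.6.1) ⟹ e.v.p. classification ∧ partition of `Π(G′)` ∧ Thm. 14.6.4 (a)
    (h64 : (InnerFormSec146.gammaSph TG' (CompactlySupportedContinuousMap (cmDatum L 3 (Matrix.of fun i j : Fin 3 => if i.val + j.val + 1 = 3 then (1 : L) else 0)).Adelic ℂ)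
        (CompactlySupportedContinuousMap ((cmDatum L 2 (Matrix.of fun i j : Fin 2 => if i.val + j.val + 1 = 2 then (1 : L) else 0)).Adelic × (cmDatum L 1 (Matrix.of fun i j : Fin 1 => if i.val + j.val + 1 = 1 then (1 : L) else 0)).Adelic) ℂ) L ι H T hT μA
        (xiPacketFamilyOfRecordSCD L H hH hHd μω hμu μZ keys (hSCD_of_cmCharIdentityPackageTestSigned L H hH hHd μω hμu Δ mH mG νG νH μZ hQS)) 𝔩 X).thm1461 (fun f' f => Smooth f' ∧ Transfer f' f) TransferH →
      (InnerFormSec146.gammaSph TG' (CompactlySupportedContinuousMap (cmDatum L 3 (Matrix.of fun i j : Fin 3 => if i.val + j.val + 1 = 3 then (1 : L) else 0)).Adelic ℂ)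
        (CompactlySupportedContinuousMap ((cmDatum L 2 (Matrix.of fun i j : Fin 2 => if i.val + j.val + 1 = 2 then (1 : L) else 0)).Adelic × (cmDatum L 1 (Matrix.of fun i j : Fin 1 => if i.val + j.val + 1 = 1 then (1 : L) else 0)).Adelic) ℂ) L ι H T hT μA
        (xiPacketFamilyOfRecordSCD L H hH hHd μω hμu μZ keys (hSCD_of_cmCharIdentityPackageTestSigned L H hH hHd μω hμu Δ mH mG νG νH μZ hQS)) 𝔩 X).sec146_evp ∧
      (InnerFormSec146.gammaSph TG' (CompactlySupportedContinuousMap (cmDatum L 3 (Matrix.of fun i j : Fin 3 => if i.val + j.val + 1 = 3 then (1 : L) else 0)).Adelic ℂ)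
        (CompactlySupportedContinuousMap ((cmDatum L 2 (Matrix.of fun i j : Fin 2 => if i.val + j.val + 1 = 2 then (1 : L) else 0)).Adelic × (cmDatum L 1 (Matrix.of fun i j : Fin 1 => if i.val + j.val + 1 = 1 then (1 : L) else 0)).Adelic) ℂ) L ι H T hT μA
        (xiPacketFamilyOfRecordSCD L H hH hHd μω hμu μZ keys (hSCD_of_cmCharIdentityPackageTestSigned L H hH hHd μω hμu Δ mH mG νG νH μZ hQS)) 𝔩 X).sec146_partition ∧
      (InnerFormSec146.gammaSph TG' (CompactlySupportedContinuousMap (cmDatum L 3 (Matrix.of fun i j : Fin 3 => if i.val + j.val + 1 = 3 then (1 : L) else 0)).Adelic ℂ)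
        (CompactlySupportedContinuousMap ((cmDatum L 2 (Matrix.of fun i j : Fin 2 => if i.val + j.val + 1 = 2 then (1 : L) else 0)).Adelic × (cmDatum L 1 (Matrix.of fun i j : Fin 1 => if i.val + j.val + 1 = 1 then (1 : L) else 0)).Adelic) ℂ) L ι H T hT μA
        (xiPacketFamilyOfRecordSCD L H hH hHd μω hμu μZ keys (hSCD_of_cmCharIdentityPackageTestSigned L H hH hHd μω hμu Δ mH mG νG νH μZ hQS)) 𝔩 X).thm1464a)
    -- (S5) the packet `Π(ξ)` OF RECORD on the `G`-side and «`Π(ξ) ∈ Π_a(G)`»; (J9) «`t(Π′(ξ)) = t(Π(ξ))`» read at the kit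
    (Pξ : X.G.Packet) (hA : X.G.IsAPacket Pξ)
    (hevpXi : InnerFormSec146.evp L H μA (xiPacketFamilyOfRecordSCD L H hH hHd μω hμu μZ keys (hSCD_of_cmCharIdentityPackageTestSigned L H hH hHd μω hμu Δ mH mG νG νH μZ hQS)) 𝔩
      (InnerFormSec146.piXiPrime L H μA (xiPacketFamilyOfRecordSCD L H hH hHd μω hμu μZ keys (hSCD_of_cmCharIdentityPackageTestSigned L H hH hHd μω hμu Δ mH mG νG νH μZ hQS)) ξ) (X.finOfG Pξ)) :
      ∀ (v : HeightOneSpectrum (𝓞 ↥(maximalRealSubfield L))) (hns : ∀ w : PlacesOver L v, IsCMField.complexConj L • w.1 = w.1),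
      ∀ (T : GL (Fin 3) (LocalRing L v)) (a : LocalRing L v) (ha : IsUnit a)
        (h : formCongr (conjLocal L (IsCMField.complexConj L) v) T (H.map (algebraMap L (LocalRing L v))) =
          a • (Matrix.of fun i j : Fin 3 => if i.val + j.val + 1 = 3 then (1 : L) else 0).map (algebraMap L (LocalRing L v))),
      ∀ [MeasurableSpace (Gqs L v ⧸ Subgroup.center (Gqs L v))] [BorelSpace (Gqs L v ⧸ Subgroup.center (Gqs L v))]
        (μZ : Measure (Gqs L v ⧸ Subgroup.center (Gqs L v))) [μZ.IsHaarMeasure],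
      ∀ (π2 πn : IrrClass (Gqs L v)),
      ∀ (hK : KeysCaseTwoLabels L v (μω.semilocalComponent L v) (torusLocalComponent L (IsCMField.complexConj L) v ξ.η)
          (torusLocalComponent L (IsCMField.complexConj L) v ξ.ψ) π2 πn)
        (hn : ¬ πn.IsSquareIntegrable μZ),
        -- (S-G) «13.3.6 (c) ∕ §14.6 AT PRINT'S PINNED DATA»: every v-constituent of P is πⁿ ∘ e, π² ∘ e, or the πˢ(ξ_v) ∘ e of `hQS`
        ∀ c : IrrClass ((cmDatum L 3 H).Local v),
          (IrrClass.comap (localPiEquiv L (IsCMField.complexConj L) 3 H v) c).IsConstituentOf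
              (P.finRep.smoothPart.toRepresentation.comp (inclPlace (↥(maximalRealSubfield L)) L (IsCMField.complexConj L) 3 H v)) →
          c = IrrClass.comap (cmDatumLocalCongr L v T ha h).symm πn ∨
            c = IrrClass.comap (cmDatumLocalCongr L v T ha h).symm π2 ∨
            c = ((hQS ξ).1 v hns T a ha h μZ π2 πn hK hn).πs := by
  refine definiteAeRigidityAt_of_parts' L H hH hHd Δ mH mG νG νH μω hμu hQS ξ μA P hAE
    (InnerFormSec146.gammaSph TG' (CompactlySupportedContinuousMap (cmDatum L 3 (Matrix.of fun i j : Fin 3 => if i.val + j.val + 1 = 3 then (1 : L) else 0)).Adelic ℂ)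
        (CompactlySupportedContinuousMap ((cmDatum L 2 (Matrix.of fun i j : Fin 2 => if i.val + j.val + 1 = 2 then (1 : L) else 0)).Adelic × (cmDatum L 1 (Matrix.of fun i j : Fin 1 => if i.val + j.val + 1 = 1 then (1 : L) else 0)).Adelic) ℂ) L ι H T hT μA
        (xiPacketFamilyOfRecordSCD L H hH hHd μω hμu μZ keys (hSCD_of_cmCharIdentityPackageTestSigned L H hH hHd μω hμu Δ mH mG νG νH μZ hQS)) 𝔩 X)
    (fun f' f => Smooth f' ∧ Transfer f' f) TransferH SθG SθH ?_ PSVanish PSVanishH MatchH h62 h38 hexH hH61 hvan hvanH h64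
    (InnerFormSec146.gammaSph_dSplit _ _ _ L ι H T hT μA _ 𝔩 X) (InnerFormSec146.classOfSph L ι H T hT μA P hsph)
    (InnerFormSec146.gammaSph_m'_ne_zero _ _ _ L ι H T hT μA _ 𝔩 X hanis _) Pξ hA (aeString_of_ae L H hH hHd hanis μω hμu hμω ξ μA P) (fun _ => ?_) ?_
  · -- (S6) SEAM 8: Thm. 14.5.1 (b) in kit shape, curried into `Γ₀.thm1451b Transfer₀ TransferH SθG SθH`
    intro f' f fH hT' hH'
    exact h51k f' f fH hT'.1 ⟨hT'.2, hH'⟩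
  · -- `hevp` at the datum: (AE) + «t(Π′(ξ)) = t(Π(ξ))» ⟹ «t(P) = t(Π(ξ))» (α2), read back by `rfl`
    exact (InnerFormSec146.gammaSph_evpRep_classOfSph _ _ _ L ι H T hT μA _ 𝔩 X P hsph Pξ).2
      ((InnerFormSec146.evpRep_classOf L H μA 𝔩 P (X.finOfG Pξ)).1
        (evpRep_of_ae_of_evp_piXiPrime L H hH hHd Δ mH mG νG νH μω hμu hQS μZ keys ξ μA P hanis hAE 𝔩 (X.finOfG Pξ) hevpXi))
  · -- `hback` at the datum: membership in `Π′(ξ′)` READ BACK (★ `gammaSph_mem'_piXi'_classOfSph`), then the signed read-back of the record (α1)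
    intro ξ' h₁ hS _ hmem
    exact sgTail_of_ae_of_recordSCD L H hH hHd Δ mH mG νG νH μω hμu hQS μZ keys
      (hSCD_of_cmCharIdentityPackageTestSigned L H hH hHd μω hμu Δ mH mG νG νH μZ hQS) hanis hμω
      (fun ξ₂ v hns T₂ a₂ ha₂ h₂ π2 πn hK hn =>
        hSCD_of_cmCharIdentityPackageTestSigned_fst L H hH hHd μω hμu Δ mH mG νG νH μZ hQS ξ₂ v hns T₂ a₂ ha₂ h₂ π2 πn hK hn)
      ξ μA P hAE (X.oneDimOf ξ' h₁)
      ((InnerFormSec146.gammaSph_mem'_piXi'_classOfSph _ _ _ L ι H T hT μA _ 𝔩 X P hsph ξ' h₁ hS).1 hmem)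

end Summit.HodgeConjecture.HodgeConjecture.R90.S9

end
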